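import Literature.AlgebraicGeometry.AbelianVarieties.HomogeneousLineBundleDivisor
import Literature.AlgebraicGeometry.Motives.AbelianVarietyTranslation
import Literature.AlgebraicGeometry.Motives.AbelianVarietyTranslationProofs
import HarnessLib

/-!
# The theorem of the square in `Ȟ¹(A, 𝒪_A^×)` and `φ_c` on torsion points

Layers `Literature/AlgebraicGeometry/Modules` (§1) and `…/AbelianVarieties` (§§3–6); namespaces follow
the layers. THEOREMS AND ONE REAL DEFINITION (`phiPic`, with the bundled `phiPicHom`, `phiPicAt`);
NO named fact, NO instance, NO notation. Companion (§2 of the same programme): the determinant class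
`KTheory.detClassC E hE = det χ(E)` of a complex of vector bundles, `KTheory/DeterminantOfComplex`.

The tree states the theorem of the square for an abelian variety `A` over a field `K` in the
currency of Cartier divisors — `AbelianVariety.theoremOfTheSquare A :
∀ x y D, t_{xy}^*D + D ∼ t_x^*D + t_y^*D` (`Motives/AbelianVarietyTranslation`, Görtz–Wedhorn II,
Thm. 27.168 with (27.30.2)), PROVED there from the cubical structure
(`theoremOfTheSquare_of_cubicalStructure`, the named fact `AbelianVariety.cubicalStructure_linEquiv` =
Görtz–Wedhorn II, Prop. 27.167, the theorem of the cube) — and, separately, the dictionary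
`DivCl(A) ≅ Ȟ¹(A, 𝒪_A^×) = CechPic A` on an integral scheme (`Modules/RankOneModuleDivisorDictionary`:
`cechClass_add`, `cechClass_pullback`, `cechClass_eq_iff_linEquiv`, `CechPic.exists_cechClass_eq`) and
the classification of rank-one modules by their class (`Modules/DetClassOfIso`,
`nonempty_iso_iff_detClass_eq`). This file moves the theorem of the square across the dictionary and
draws the consequences a consumer working with CLASSES and MODULES (rather than divisors) needs:

* §1 `CechPic.pullback_id` — `(𝟙_X)^* = id` on `Ȟ¹(X, 𝒪_X^×)` (the companion `CechPic.pullback_comp`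
  is `Modules/UnitCocyclePresented`).
* §3 **the theorem of the square in `Ȟ¹(A, 𝒪_A^×)`**: `t_{xy}^*c · c = t_x^*c · t_y^*c` for every class
  `c` and all `x, y ∈ A(K)` (`pullback_translation_mul_mul_self`, from `A.theoremOfTheSquare`;
  Lange, Thm. 1.3.5; Mumford §6 Cor. 4), the converse `theoremOfTheSquare_of_cechPic` and the
  equivalence `theoremOfTheSquare_iff_cechPic`; the variant from the cubical structure.
* §4 **`φ_c : A(K) → Ȟ¹(A, 𝒪_A^×)`, `x ↦ t_x^*c · c⁻¹`** (`AbelianVarieties.phiPic`; Lange §1.4.2,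
  Mumford §8 `Λ(L)`), a homomorphism in `x` granted the theorem of the square (`phiPic_mul`,
  bundled `phiPicHom`), a homomorphism in `c` unconditionally (`phiPic_mul_class`, `phiPic_zpow_class`:
  Lange Prop. 1.4.6 (b), `φ_{L⊗M} = φ_L + φ_M`), and `φ_{[𝒪(D)]}(x) = 1 ↔ x ∈ K(D)`
  (`phiPic_cechClass_eq_one_iff_mem_KTheta`, the tree's `AbelianVariety.KTheta`).
* §5 **`φ_{cⁿ}` kills the `n`-torsion**: `x ^ n = 1 ⟹ t_x^*(cⁿ) = cⁿ`
  (`pullback_translation_zpow_eq_self`, `…_of_mem_torsionPoints`, `…_of_dvd`).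
* §6 **module form**: a rank-one module `N` with `[det N] = γⁿ` satisfies `t_x^*N ≅ N` for every
  `x ∈ A[n](K)` (`nonempty_pullback_translation_iso_of_detClass_eq_zpow`).
* §7 **unconditional forms**: §§3–6 take the theorem of the square as the hypothesis
  `(hsq : A.theoremOfTheSquare)`; the tree DISCHARGES it (`AbelianVariety.theoremOfTheSquare_holds`,
  `Motives/AbelianVarietyTranslationProofs`, Görtz–Wedhorn II 23.133 ⟹ 24.73 ⟹ 27.167 ⟹ 27.168), and
  the primed names `pullback_translation_mul_mul_self'`, `phiPic_mul'`, `phiPic_inv'`, `phiPic_zpow'`,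
  `pullback_translation_zpow_eq_self'`, `…_of_mem_torsionPoints'`, `…_of_dvd'`,
  `nonempty_pullback_translation_iso_of_detClass_eq_zpow'`, `…_of_dvd'` are the same statements with
  no hypothesis at all.

Deliberately NOT here: `φ_L` as a morphism `A → Â`, `Pic⁰`, tensor powers of modules
(`[det M^{⊗n}] = [det M]ⁿ` needs local freeness of `⊗`), the twist `t_x^*(E ⊗ N) ≅ t_x^*E ⊗ N`.

## References

* H. Lange, *Abelian Varieties over the Complex Numbers*, Grundlehren Text Editions (2023):
  Thm. 1.3.5 (theorem of the square), §1.4.2 (`φ_L : x ↦ t_x^*L ⊗ L⁻¹` "which, according to the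
  Theorem of the Square 1.3.5, is a homomorphism"), Prop. 1.4.6 (b) (`φ_{L⊗M} = φ_L + φ_M`).
  [Lange2023AbelianVarietiesC] (held, mis-keyed, as `book:lange1992-complex-abelian-varieties`,
  chunks 39 and 44)
* D. Mumford, *Abelian Varieties* (1970), §6 Cor. 4 (p. 59) (theorem of the square), §8 (`K(L)`,
  `Pic⁰`). [MumfordAV1970]
* U. Görtz, T. Wedhorn, *Algebraic Geometry II* (2023), Prop. 27.167, Thm. 27.168 with (27.30.2)
  (p. 878). [GortzWedhorn2023]
* R. Hartshorne, *Algebraic Geometry* (1977), II Ex. 6.8 (a), III Ex. 4.5. [Hartshorne1977]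
-/

noncomputable section

open CategoryTheory AlgebraicGeometry Opposite TopologicalSpace

universe u

/-! ### §1 `(𝟙_X)^* = id` on `Ȟ¹(X, 𝒪_X^×)` -/

namespace Literature.AlgebraicGeometry.Modules

namespace CechPic

variable {X : Scheme.{u}}

/-- **`(𝟙_X)^* = id`** on `Ȟ¹(X, 𝒪_X^×)`: `L ↦ f^*L` is functorial (Hartshorne II Ex. 6.8 (a); the
pulled-back cocycle along the identity is the same cocycle on the same cover). [cite: Hartshorne1977, II Ex. 6.8 (a)] -/
@[simp]
theorem pullback_id (c : CechPic X) : pullback (𝟙 X) c = c := by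
  obtain ⟨c, rfl⟩ := mk_surjective c
  rw [pullback_mk]
  refine sound (UnitCocycle.equiv_of_eq _ _ c.U c.mem (fun _ => le_rfl) (fun _ => le_rfl)
    fun x y V hx hy => ?_)
  -- `(𝟙 X).appLE U V e = 𝟙 ≫ 𝒪_X(U → V)` is the restriction map
  change c.g x y V _ _ = secRes X _ (c.g x y _ _ _)
  exact (c.map_g x y _ _ _).symm

end CechPic

end Literature.AlgebraicGeometry.Modules

/-! ### §3 The theorem of the square in `Ȟ¹(A, 𝒪_A^×)` -/

namespace Literature.AlgebraicGeometry.AbelianVarieties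

open Literature.AlgebraicGeometry.Motives Literature.AlgebraicGeometry.Modules

variable {K : Type u} [Field K] (A : AbelianVariety K)

/-- **The theorem of the square in `Ȟ¹(A, 𝒪_A^×)`**: granting the theorem of the square for `A` in
its Cartier-divisor form (`A.theoremOfTheSquare`, Görtz–Wedhorn II Thm. 27.168, proved in the tree from
the cubical structure), for every class `c ∈ Ȟ¹(A, 𝒪_A^×)` and all rational points `x, y ∈ A(K)`,
`t_{xy}^*c · c = t_x^*c · t_y^*c` — Lange, Thm. 1.3.5: "`t_{v+w}^*L = t_v^*L ⊗ t_w^*L ⊗ L⁻¹`";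
Mumford §6 Cor. 4: "`T_{x+y}^*L ⊗ L ≅ T_x^*L ⊗ T_y^*L`". Proof: write `c = [𝒪_A(D)]`
(`CechPic.exists_cechClass_eq`, `A` is integral) and transport `t_{xy}^*D + D ∼ t_x^*D + t_y^*D`
through `[𝒪(D + E)] = [𝒪(D)][𝒪(E)]`, `[𝒪(t^*D)] = t^*[𝒪(D)]`. [cite: Lange2023AbelianVarietiesC, Thm. 1.3.5]
[cite: MumfordAV1970, §6 Cor. 4 (p. 59)] [cite: GortzWedhorn2023, Thm. 27.168 with (27.30.2) (p. 878)] -/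
theorem pullback_translation_mul_mul_self (hsq : A.theoremOfTheSquare) (c : CechPic A.X.left)
    (x y : A.Points K) :
    CechPic.pullback (A.translation (x * y)).left c * c =
      CechPic.pullback (A.translation x).left c * CechPic.pullback (A.translation y).left c := by
  obtain ⟨D, rfl⟩ := CechPic.exists_cechClass_eq c
  rw [← D.cechClass_pullback, ← D.cechClass_pullback, ← D.cechClass_pullback,
    ← CartierDivisor.cechClass_add, ← CartierDivisor.cechClass_add]
  exact (hsq x y D).cechClass_eq

/-- Conversely, the identity `t_{xy}^*c · c = t_x^*c · t_y^*c` for all classes gives back the theorem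
of the square for divisors (`DivCl(A) → Ȟ¹(A, 𝒪_A^×)` is injective, `cechClass_eq_iff_linEquiv`).
[cite: GortzWedhorn2023, Thm. 27.168 with (27.30.2) (p. 878)] -/
theorem theoremOfTheSquare_of_cechPic
    (h : ∀ (c : CechPic A.X.left) (x y : A.Points K),
      CechPic.pullback (A.translation (x * y)).left c * c =
        CechPic.pullback (A.translation x).left c * CechPic.pullback (A.translation y).left c) :
    A.theoremOfTheSquare := fun x y D =>
  CartierDivisor.linEquiv_of_cechClass_eq (by
    rw [CartierDivisor.cechClass_add, CartierDivisor.cechClass_add, D.cechClass_pullback,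
      D.cechClass_pullback, D.cechClass_pullback]
    exact h _ x y)

/-- **The theorem of the square, divisor form ⟺ class form.**
[cite: GortzWedhorn2023, Thm. 27.168 with (27.30.2) (p. 878)] -/
theorem theoremOfTheSquare_iff_cechPic :
    A.theoremOfTheSquare ↔ ∀ (c : CechPic A.X.left) (x y : A.Points K),
      CechPic.pullback (A.translation (x * y)).left c * c =
        CechPic.pullback (A.translation x).left c * CechPic.pullback (A.translation y).left c :=
  ⟨pullback_translation_mul_mul_self A, theoremOfTheSquare_of_cechPic A⟩

/-- The class form of the theorem of the square from the cubical structure (Görtz–Wedhorn II,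
Prop. 27.167 ⟹ Thm. 27.168). [cite: GortzWedhorn2023, Thm. 27.168, proof (p. 878)] -/
theorem pullback_translation_mul_mul_self_of_cubicalStructure (h : A.cubicalStructure_linEquiv)
    (c : CechPic A.X.left) (x y : A.Points K) :
    CechPic.pullback (A.translation (x * y)).left c * c =
      CechPic.pullback (A.translation x).left c * CechPic.pullback (A.translation y).left c :=
  pullback_translation_mul_mul_self A (AbelianVariety.theoremOfTheSquare_of_cubicalStructure h) c x y

/-! ### §4 `φ_c : A(K) → Ȟ¹(A, 𝒪_A^×)`, `x ↦ t_x^*c · c⁻¹` -/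

/-- **`φ_c(x) = t_x^*c · c⁻¹ ∈ Ȟ¹(A, 𝒪_A^×)`** for a class `c` and a rational point `x ∈ A(K)`:
Lange, §1.4.2, "`φ_L : X → X̂, x ↦ t_x^*L ⊗ L⁻¹`" (Mumford §8, `Λ(L)`), here on `K`-rational points and
with values in all of `Ȟ¹(A, 𝒪_A^×)` (the tree has no `Pic⁰`/dual as the target; the values are
homogeneous classes whenever the theorem of the square holds). [cite: Lange2023AbelianVarietiesC, §1.4.2] -/
def phiPic (c : CechPic A.X.left) (x : A.Points K) : CechPic A.X.left :=
  CechPic.pullback (A.translation x).left c / c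

/-- `t_x^*c = φ_c(x) · c` (Lange §1.4.2, the definition of `φ_L` read backwards). [cite: Lange2023AbelianVarietiesC, §1.4.2] -/
theorem pullback_translation_eq_phiPic_mul (c : CechPic A.X.left) (x : A.Points K) :
    CechPic.pullback (A.translation x).left c = phiPic A c x * c :=
  (div_mul_cancel _ _).symm

/-- `φ_c(x) = 1 ⟺ t_x^*c = c`, i.e. `x ∈ K(c)` (Mumford §6, Definition p. 60: `K(L) = {x ; T_x^*L ≅ L}`).
[cite: MumfordAV1970, §6 Definition (p. 60) and §8] -/
theorem phiPic_eq_one_iff (c : CechPic A.X.left) (x : A.Points K) :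
    phiPic A c x = 1 ↔ CechPic.pullback (A.translation x).left c = c :=
  div_eq_one

/-- **`φ_c(1) = 1`** (`t_1 = 𝟙_A` and `(𝟙_A)^* = id`). [cite: Lange2023AbelianVarietiesC, §1.4.2] -/
@[simp]
theorem phiPic_one (c : CechPic A.X.left) : phiPic A c 1 = 1 := by
  rw [phiPic_eq_one_iff, AbelianVariety.translation_one]
  exact CechPic.pullback_id c

/-- **`φ_c` is a homomorphism** granted the theorem of the square: `φ_c(xy) = φ_c(x) φ_c(y)`
(Lange §1.4.2: "which, according to the Theorem of the Square 1.3.5, is a homomorphism").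
[cite: Lange2023AbelianVarietiesC, §1.4.2 and Thm. 1.3.5] -/
theorem phiPic_mul (hsq : A.theoremOfTheSquare) (c : CechPic A.X.left) (x y : A.Points K) :
    phiPic A c (x * y) = phiPic A c x * phiPic A c y := by
  unfold phiPic
  rw [div_mul_div_comm, ← pullback_translation_mul_mul_self A hsq c x y, mul_div_mul_right_eq_div]

/-- **`φ_c : A(K) →* Ȟ¹(A, 𝒪_A^×)` as a group homomorphism**, granted the theorem of the square.
[cite: Lange2023AbelianVarietiesC, §1.4.2 and Thm. 1.3.5] -/
def phiPicHom (hsq : A.theoremOfTheSquare) (c : CechPic A.X.left) : A.Points K →* CechPic A.X.left where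
  toFun := phiPic A c
  map_one' := phiPic_one A c
  map_mul' := phiPic_mul A hsq c

/-- Unfolding the bundled `φ_c`. [cite: Lange2023AbelianVarietiesC, §1.4.2] -/
@[simp]
theorem phiPicHom_apply (hsq : A.theoremOfTheSquare) (c : CechPic A.X.left) (x : A.Points K) :
    phiPicHom A hsq c x = phiPic A c x := rfl

/-- `φ_c(x⁻¹) = φ_c(x)⁻¹` granted the theorem of the square (`φ_c` is a homomorphism).
[cite: Lange2023AbelianVarietiesC, §1.4.2 and Thm. 1.3.5] -/
theorem phiPic_inv (hsq : A.theoremOfTheSquare) (c : CechPic A.X.left) (x : A.Points K) :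
    phiPic A c x⁻¹ = (phiPic A c x)⁻¹ :=
  map_inv (phiPicHom A hsq c) x

/-- `φ_c(xⁿ) = φ_c(x)ⁿ` (`n : ℤ`) granted the theorem of the square (`φ_c` is a homomorphism).
[cite: Lange2023AbelianVarietiesC, §1.4.2 and Thm. 1.3.5] -/
theorem phiPic_zpow (hsq : A.theoremOfTheSquare) (c : CechPic A.X.left) (x : A.Points K) (n : ℤ) :
    phiPic A c (x ^ n) = phiPic A c x ^ n :=
  map_zpow (phiPicHom A hsq c) x n

/-- **`φ_{c c'} = φ_c · φ_{c'}`** (Lange, Prop. 1.4.6 (b): "`φ_{L⊗M} = φ_L + φ_M`"); this half needs no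
theorem of the square (`t_x^*` is a homomorphism). [cite: Lange2023AbelianVarietiesC, Prop. 1.4.6 (b)] -/
theorem phiPic_mul_class (c c' : CechPic A.X.left) (x : A.Points K) :
    phiPic A (c * c') x = phiPic A c x * phiPic A c' x := by
  unfold phiPic
  rw [map_mul, mul_div_mul_comm]

/-- `φ_1 = 1` (the trivial class is translation invariant). [cite: Lange2023AbelianVarietiesC, Prop. 1.4.6 (b)] -/
@[simp]
theorem phiPic_one_class (x : A.Points K) : phiPic A 1 x = 1 := by
  unfold phiPic
  rw [map_one, div_one]

/-- `φ_{c⁻¹} = φ_c⁻¹`. [cite: Lange2023AbelianVarietiesC, Prop. 1.4.6 (b)] -/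
theorem phiPic_inv_class (c : CechPic A.X.left) (x : A.Points K) :
    phiPic A c⁻¹ x = (phiPic A c x)⁻¹ := by
  unfold phiPic
  rw [map_inv, inv_div_inv, inv_div]

/-- **`φ_{cⁿ} = φ_cⁿ`** (`n : ℤ`; Lange, Prop. 1.4.6 (b) iterated). [cite: Lange2023AbelianVarietiesC, Prop. 1.4.6 (b)] -/
theorem phiPic_zpow_class (c : CechPic A.X.left) (n : ℤ) (x : A.Points K) :
    phiPic A (c ^ n) x = phiPic A c x ^ n := by
  unfold phiPic
  rw [map_zpow, div_zpow]

/-- For each `x`, `c ↦ φ_c(x)` is a group homomorphism `Ȟ¹(A, 𝒪_A^×) →* Ȟ¹(A, 𝒪_A^×)`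
(unconditionally). [cite: Lange2023AbelianVarietiesC, Prop. 1.4.6 (b)] -/
def phiPicAt (x : A.Points K) : CechPic A.X.left →* CechPic A.X.left where
  toFun c := phiPic A c x
  map_one' := phiPic_one_class A x
  map_mul' c c' := phiPic_mul_class A c c' x

/-- Unfolding `phiPicAt`. [cite: Lange2023AbelianVarietiesC, Prop. 1.4.6 (b)] -/
@[simp]
theorem phiPicAt_apply (x : A.Points K) (c : CechPic A.X.left) : phiPicAt A x c = phiPic A c x := rfl

/-- **`φ_{[𝒪_A(D)]}(x) = 1 ⟺ x ∈ K(D)`**: on the class of a Cartier divisor, `φ` is trivial exactly on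
the tree's `AbelianVariety.KTheta D = {x ; t_x^*D ∼ D}` (Mumford §6/§8, `K(L)`; injectivity of
`DivCl(A) → Ȟ¹(A, 𝒪_A^×)`). [cite: MumfordAV1970, §8 (definition of K(L) and Pic⁰)] -/
theorem phiPic_cechClass_eq_one_iff_mem_KTheta (D : CartierDivisor A.X.left) (x : A.Points K) :
    phiPic A D.cechClass x = 1 ↔ x ∈ A.KTheta D := by
  rw [phiPic_eq_one_iff, ← D.cechClass_pullback, CartierDivisor.cechClass_eq_iff_linEquiv,
    AbelianVariety.mem_KTheta_iff']

/-! ### §5 `φ_{cⁿ}` kills the `n`-torsion: `t_x^*(cⁿ) = cⁿ` for `xⁿ = 1` -/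

/-- **`φ_{cⁿ}(x) = 1` when `xⁿ = 1`** (`n : ℤ`): `φ_{cⁿ}(x) = φ_c(x)ⁿ = φ_c(xⁿ) = φ_c(1) = 1`, granted
the theorem of the square. [cite: Lange2023AbelianVarietiesC, Thm. 1.3.5 and Prop. 1.4.6 (b)] -/
theorem phiPic_zpow_eq_one_of_zpow_eq_one (hsq : A.theoremOfTheSquare) (c : CechPic A.X.left)
    {n : ℤ} {x : A.Points K} (hx : x ^ n = 1) : phiPic A (c ^ n) x = 1 := by
  rw [phiPic_zpow_class, ← phiPic_zpow A hsq, hx, phiPic_one]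

/-- **`t_x^*(cⁿ) = cⁿ` in `Ȟ¹(A, 𝒪_A^×)` when `xⁿ = 1`** (`n : ℤ`), granted the theorem of the square:
the `n`-th power of any line bundle class is invariant under translation by `n`-torsion points.
[cite: Lange2023AbelianVarietiesC, Thm. 1.3.5 and Prop. 1.4.6 (b)] [cite: MumfordAV1970, §6 Cor. 4 (p. 59)] -/
theorem pullback_translation_zpow_eq_self (hsq : A.theoremOfTheSquare) (c : CechPic A.X.left)
    {n : ℤ} {x : A.Points K} (hx : x ^ n = 1) :
    CechPic.pullback (A.translation x).left (c ^ n) = c ^ n := by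
  rw [pullback_translation_eq_phiPic_mul, phiPic_zpow_eq_one_of_zpow_eq_one A hsq c hx, one_mul]

/-- `t_x^*(cⁿ) = cⁿ` for `x ∈ A[n](K)` (the tree's `AbelianVariety.torsionPoints`), granted the
theorem of the square. [cite: Lange2023AbelianVarietiesC, Thm. 1.3.5 and Prop. 1.4.6 (b)] -/
theorem pullback_translation_zpow_of_mem_torsionPoints (hsq : A.theoremOfTheSquare)
    (c : CechPic A.X.left) {n : ℤ} {x : A.Points K} (hx : x ∈ A.torsionPoints K n) :
    CechPic.pullback (A.translation x).left (c ^ n) = c ^ n :=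
  pullback_translation_zpow_eq_self A hsq c ((AbelianVariety.mem_torsionPoints_iff n x).1 hx)

/-- `t_x^*(cⁿ) = cⁿ` (`n : ℕ`) for `x ∈ A[n](K)`, granted the theorem of the square.
[cite: Lange2023AbelianVarietiesC, Thm. 1.3.5 and Prop. 1.4.6 (b)] -/
theorem pullback_translation_pow_of_mem_torsionPoints (hsq : A.theoremOfTheSquare)
    (c : CechPic A.X.left) {n : ℕ} {x : A.Points K} (hx : x ∈ A.torsionPoints K n) :
    CechPic.pullback (A.translation x).left (c ^ n) = c ^ n := by
  rw [← zpow_natCast]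
  exact pullback_translation_zpow_of_mem_torsionPoints A hsq c hx

/-- `t_x^*(cⁿ) = cⁿ` for `x ∈ A[m](K)` and `m ∣ n` (e.g. `x` two-torsion and `n` even), granted the
theorem of the square. [cite: Lange2023AbelianVarietiesC, Thm. 1.3.5 and Prop. 1.4.6 (b)] -/
theorem pullback_translation_zpow_of_mem_torsionPoints_of_dvd (hsq : A.theoremOfTheSquare)
    (c : CechPic A.X.left) {m n : ℤ} (hmn : m ∣ n) {x : A.Points K} (hx : x ∈ A.torsionPoints K m) :
    CechPic.pullback (A.translation x).left (c ^ n) = c ^ n := by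
  obtain ⟨k, rfl⟩ := hmn
  refine pullback_translation_zpow_eq_self A hsq c ?_
  rw [zpow_mul, (AbelianVariety.mem_torsionPoints_iff m x).1 hx, one_zpow]

/-! ### §6 Module form: line bundles of class `γⁿ` are invariant under `A[n]` -/

/-- **`t_x^*N ≅ N` for a rank-one module `N` with `[det N] = γⁿ` and `x ∈ A[n](K)`**, granted the
theorem of the square: rank-one modules are classified by their determinant class
(`nonempty_iso_iff_detClass_eq`), `[det t_x^*N] = t_x^*[det N]` (`detClass_pullback`), and
`t_x^*(γⁿ) = γⁿ` (§5). This is the module statement "`t_x^*(M^{⊗n}) ≅ M^{⊗n}` for `x ∈ A[n]`" for any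
line bundle `N` whose class is `[M]ⁿ` (take `γ = [det M]`).
[cite: Lange2023AbelianVarietiesC, Thm. 1.3.5 and Prop. 1.4.6 (b)] [cite: Hartshorne1977, III Ex. 4.5] -/
theorem nonempty_pullback_translation_iso_of_detClass_eq_zpow (hsq : A.theoremOfTheSquare)
    {N : A.X.left.Modules} (h₁ : HasRank N 1) (hN : IsFiniteLocallyFree N) {γ : CechPic A.X.left}
    {n : ℤ} (hγ : detClass hN = γ ^ n) {x : A.Points K} (hx : x ∈ A.torsionPoints K n) :
    Nonempty ((Scheme.Modules.pullback (A.translation x).left).obj N ≅ N) := by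
  rw [nonempty_iso_iff_detClass_eq (hasRank_pullback _ h₁) h₁ (hN.pullback _) hN,
    detClass_pullback (hE := hN), hγ]
  exact pullback_translation_zpow_of_mem_torsionPoints A hsq γ hx

/-- The same with `x ∈ A[m](K)`, `m ∣ n` (e.g. the square of a class is invariant under the
two-torsion, and so is every even power). [cite: Lange2023AbelianVarietiesC, Thm. 1.3.5 and Prop. 1.4.6 (b)] -/
theorem nonempty_pullback_translation_iso_of_detClass_eq_zpow_of_dvd (hsq : A.theoremOfTheSquare)
    {N : A.X.left.Modules} (h₁ : HasRank N 1) (hN : IsFiniteLocallyFree N) {γ : CechPic A.X.left}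
    {m n : ℤ} (hmn : m ∣ n) (hγ : detClass hN = γ ^ n) {x : A.Points K}
    (hx : x ∈ A.torsionPoints K m) :
    Nonempty ((Scheme.Modules.pullback (A.translation x).left).obj N ≅ N) := by
  rw [nonempty_iso_iff_detClass_eq (hasRank_pullback _ h₁) h₁ (hN.pullback _) hN,
    detClass_pullback (hE := hN), hγ]
  exact pullback_translation_zpow_of_mem_torsionPoints_of_dvd A hsq γ hmn hx

/-- **A rank-one module whose class is fixed by `t_x^*` is `t_x`-invariant**: `t_x^*[det N] = [det N]
⟹ t_x^*N ≅ N` (and conversely), the module reading of `φ_{[N]}(x) = 1`. [cite: Hartshorne1977, III Ex. 4.5] -/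
theorem nonempty_pullback_translation_iso_iff_phiPic_eq_one {N : A.X.left.Modules} (h₁ : HasRank N 1)
    (hN : IsFiniteLocallyFree N) (x : A.Points K) :
    Nonempty ((Scheme.Modules.pullback (A.translation x).left).obj N ≅ N) ↔
      phiPic A (detClass hN) x = 1 := by
  rw [nonempty_iso_iff_detClass_eq (hasRank_pullback _ h₁) h₁ (hN.pullback _) hN,
    detClass_pullback (hE := hN), phiPic_eq_one_iff]

/-! ### §7 Unconditional forms (the theorem of the square is a theorem of the tree) -/

/-- **The theorem of the square in `Ȟ¹(A, 𝒪_A^×)`, unconditionally**: `t_{xy}^*c · c = t_x^*c · t_y^*c`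
for every class `c` and all `x, y ∈ A(K)` — §3 with `hsq` discharged by the tree's
`AbelianVariety.theoremOfTheSquare_holds`. [cite: Lange2023AbelianVarietiesC, Thm. 1.3.5]
[cite: MumfordAV1970, §6 Cor. 4 (p. 59)] [cite: GortzWedhorn2023, Thm. 27.168 with (27.30.2) (p. 878)] -/
theorem pullback_translation_mul_mul_self' (c : CechPic A.X.left) (x y : A.Points K) :
    CechPic.pullback (A.translation (x * y)).left c * c =
      CechPic.pullback (A.translation x).left c * CechPic.pullback (A.translation y).left c :=
  pullback_translation_mul_mul_self A A.theoremOfTheSquare_holds c x y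

/-- **`φ_c` is a homomorphism, unconditionally**: `φ_c(xy) = φ_c(x) φ_c(y)` (Lange §1.4.2 with
Thm. 1.3.5, the latter a theorem of the tree). [cite: Lange2023AbelianVarietiesC, §1.4.2 and Thm. 1.3.5] -/
theorem phiPic_mul' (c : CechPic A.X.left) (x y : A.Points K) :
    phiPic A c (x * y) = phiPic A c x * phiPic A c y :=
  phiPic_mul A A.theoremOfTheSquare_holds c x y

/-- `φ_c(x⁻¹) = φ_c(x)⁻¹`, unconditionally. [cite: Lange2023AbelianVarietiesC, §1.4.2 and Thm. 1.3.5] -/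
theorem phiPic_inv' (c : CechPic A.X.left) (x : A.Points K) :
    phiPic A c x⁻¹ = (phiPic A c x)⁻¹ :=
  phiPic_inv A A.theoremOfTheSquare_holds c x

/-- `φ_c(xⁿ) = φ_c(x)ⁿ` (`n : ℤ`), unconditionally. [cite: Lange2023AbelianVarietiesC, §1.4.2 and Thm. 1.3.5] -/
theorem phiPic_zpow' (c : CechPic A.X.left) (x : A.Points K) (n : ℤ) :
    phiPic A c (x ^ n) = phiPic A c x ^ n :=
  phiPic_zpow A A.theoremOfTheSquare_holds c x n

/-- **`t_x^*(cⁿ) = cⁿ` when `xⁿ = 1`** (`n : ℤ`), unconditionally: the `n`-th power of any class in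
`Ȟ¹(A, 𝒪_A^×)` is invariant under translation by `n`-torsion points.
[cite: Lange2023AbelianVarietiesC, Thm. 1.3.5 and Prop. 1.4.6 (b)] [cite: MumfordAV1970, §6 Cor. 4 (p. 59)] -/
theorem pullback_translation_zpow_eq_self' (c : CechPic A.X.left) {n : ℤ} {x : A.Points K}
    (hx : x ^ n = 1) : CechPic.pullback (A.translation x).left (c ^ n) = c ^ n :=
  pullback_translation_zpow_eq_self A A.theoremOfTheSquare_holds c hx

/-- `t_x^*(cⁿ) = cⁿ` for `x ∈ A[n](K)`, unconditionally. [cite: Lange2023AbelianVarietiesC, Thm. 1.3.5 and Prop. 1.4.6 (b)] -/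
theorem pullback_translation_zpow_of_mem_torsionPoints' (c : CechPic A.X.left) {n : ℤ}
    {x : A.Points K} (hx : x ∈ A.torsionPoints K n) :
    CechPic.pullback (A.translation x).left (c ^ n) = c ^ n :=
  pullback_translation_zpow_of_mem_torsionPoints A A.theoremOfTheSquare_holds c hx

/-- `t_x^*(cⁿ) = cⁿ` (`n : ℕ`) for `x ∈ A[n](K)`, unconditionally. [cite: Lange2023AbelianVarietiesC, Thm. 1.3.5 and Prop. 1.4.6 (b)] -/
theorem pullback_translation_pow_of_mem_torsionPoints' (c : CechPic A.X.left) {n : ℕ}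
    {x : A.Points K} (hx : x ∈ A.torsionPoints K n) :
    CechPic.pullback (A.translation x).left (c ^ n) = c ^ n :=
  pullback_translation_pow_of_mem_torsionPoints A A.theoremOfTheSquare_holds c hx

/-- `t_x^*(cⁿ) = cⁿ` for `x ∈ A[m](K)` and `m ∣ n`, unconditionally (e.g. every even power of a class is
invariant under the two-torsion). [cite: Lange2023AbelianVarietiesC, Thm. 1.3.5 and Prop. 1.4.6 (b)] -/
theorem pullback_translation_zpow_of_mem_torsionPoints_of_dvd' (c : CechPic A.X.left) {m n : ℤ}
    (hmn : m ∣ n) {x : A.Points K} (hx : x ∈ A.torsionPoints K m) :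
    CechPic.pullback (A.translation x).left (c ^ n) = c ^ n :=
  pullback_translation_zpow_of_mem_torsionPoints_of_dvd A A.theoremOfTheSquare_holds c hmn hx

/-- **`t_x^*N ≅ N` for a rank-one module `N` with `[det N] = γⁿ` and `x ∈ A[n](K)`, unconditionally**
(§6 with the theorem of the square discharged). [cite: Lange2023AbelianVarietiesC, Thm. 1.3.5 and Prop. 1.4.6 (b)]
[cite: Hartshorne1977, III Ex. 4.5] -/
theorem nonempty_pullback_translation_iso_of_detClass_eq_zpow' {N : A.X.left.Modules}
    (h₁ : HasRank N 1) (hN : IsFiniteLocallyFree N) {γ : CechPic A.X.left} {n : ℤ}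
    (hγ : detClass hN = γ ^ n) {x : A.Points K} (hx : x ∈ A.torsionPoints K n) :
    Nonempty ((Scheme.Modules.pullback (A.translation x).left).obj N ≅ N) :=
  nonempty_pullback_translation_iso_of_detClass_eq_zpow A A.theoremOfTheSquare_holds h₁ hN hγ hx

/-- The same with `x ∈ A[m](K)`, `m ∣ n`, unconditionally. [cite: Lange2023AbelianVarietiesC, Thm. 1.3.5 and Prop. 1.4.6 (b)] -/
theorem nonempty_pullback_translation_iso_of_detClass_eq_zpow_of_dvd' {N : A.X.left.Modules}
    (h₁ : HasRank N 1) (hN : IsFiniteLocallyFree N) {γ : CechPic A.X.left} {m n : ℤ} (hmn : m ∣ n)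
    (hγ : detClass hN = γ ^ n) {x : A.Points K} (hx : x ∈ A.torsionPoints K m) :
    Nonempty ((Scheme.Modules.pullback (A.translation x).left).obj N ≅ N) :=
  nonempty_pullback_translation_iso_of_detClass_eq_zpow_of_dvd A A.theoremOfTheSquare_holds h₁ hN hmn
    hγ hx

end Literature.AlgebraicGeometry.AbelianVarieties

end
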